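import Summits.QuantumFields.BalabanUV.T4Continuum.Spine.NE1p.B7AveragingLevelsCurvedBackgroundLocal
import Summits.QuantumFields.BalabanUV.T4Continuum.Spine.NE1p.B7AveragingLevelsGaugeCovariance
import Summits.QuantumFields.BalabanUV.T4Continuum.Spine.NE1p.B7AveragingCurvedBackgroundLocal

/-!
# T⁴ programme, spine estimate NE1′ (node O3b/H2) — DOOR (c) AT EVERY LEVEL `j ≤ k` FOR THE PRINTED `Q_j` (127) IN THE PRINTED LOCAL
# CURRENCY: «diagonal curvature ∝ non-flatness», the non-flatness being `sup_{p ⊂ B^j(c₋)∪B^j(c₊)} |U₀(∂p) − 1|` ITSELF — no generator,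
# every hypothesis on the background and on the slot placed on the bonds of the block pair `B^j(c₋) ∪ B^j(c₊)`

Cell `pub-balaban-gaps` (YM blitz Y1, track G2), seat `ne1` gen 11 session 3 (prover-pub-balaban-gaps-ne1-g11-0); record `HOME/ne/NE1.md`
§4 R68.  ADDITIVE — imports this seat's files 20 (`B7AveragingLevelsCurvedBackgroundLocal`, through it file 19: the Prop.-7 estimates
`analyticAt_logCovIter_slot`, `norm_levels_curvature_le_of_commute`), 21 (`B7AveragingLevelsGaugeCovariance`: `norm_iteratedDeriv_two_logCovIter_gaugeAct_le`,
gauge covariance of `Q_j` for arbitrary invertible gauge functions) and 18 (`B7AveragingCurvedBackgroundLocal`: `clampCfg_mem_U1_of_local`,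
`agreeOn_gaugeAct`, `norm_ite_zero_le_of`), and the lineages' `B7Prop1Explicit` (the axial gauge of p. 24: `axialFn`, `axialFn_mem`,
`axial_bond_bound`; `l1`), `B7Prop1Local` (`loK ∕ bondHiK ∕ PlaqIn ∕ clampCfg ∕ clampCfg_agree ∕ clampCfg_mem ∕ norm_hol_plaqWord_clampCfg_le ∕ pdevOn ∕
pdev_clampCfg_le`), `B7Prop2Explicit.hol_mem_of`, `B7AvgGaugeCovariance.pdev_gaugeAct` ((45)), `B7LocalityGeneral.logCovIter_congr`, `MatrixLog`
(`exp_mlog` (23), `norm_mlog_le_two_mul` (27)) BY NAME; nothing edited or restated; 0 def.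

PRINT.  [Balaban1985Averaging] (44) p. 24 «|U(∂p) − 1| < α₀ for p ⊂ B(c₋) ∪ B(c₊)»; p. 24–25 (the axial gauge on the block pair); (45) p. 24;
(52) p. 26 and p. 26 after (54) («it is enough to assume (52) for p ⊂ B^k(x) ∪ …»); (127) p. 37; Proposition 7 p. 43.  Files 19∕20 bound the
quadratic term of `Q_j(e^{B}U₀, τA)(c)` by the size `b` of a background GENERATOR `B`; THIS file removes the generator: at ANY background `U₀` of the
regime whose unit plaquettes inside the level-`j` block pair are within `α` of `1`, the axial gauge of p. 24 writes `U₀ ≡ (e^{B})^{v₀⁻¹}` on the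
block pair with `sup‖B‖ ≤ (4dLʲ+1)·α`, and gauge covariance (file 21) + locality (the lineage's kernel `logCovIter_congr`) transport file 19's
flat estimate to `U₀`.

WHAT THIS FILE PROVES ([folklore] bookkeeping on kernel theorems of the lineages and of this seat; 0 sorry):
* §1 `l1_sub_loK_le_of_inBox` — on the block pair `[Lʲz, Lʲz + (Lʲ−1)𝟙 + Lʲe_κ]` the `ℓ¹` distance to the corner `Lʲz` is `≤ 2dLʲ`;
  `logCovIter_slot_congr` ∕ `iteratedDeriv_two_logCovIter_slot_congr` (locality of `Q_j(U₀, τA)(c)` and of its quadratic term in `(U₀, A)` on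
  the block pair — the lineage's `logCovIter_congr`).
* §2 **`norm_levels_curvature_sub_axialFlat_le_of_plaq`** (GENERAL slot: the quadratic term at `U₀` is within «non-flatness» of the FLAT
  quadratic term of the transported slot `A♮ = vAv⁻¹`, `v` the axial gauge of the clamped `U₀` based at `Lʲz` — covariance is exact, `v(Lʲz) = 1`)
  and **`norm_levels_curvature_le_of_plaq_oneSite`** — Prop.-7 regime data as displayed hypotheses (budgets `β`, `β′` in level-`k` units);
  a `G`-valued background `U₀` with (52) ON THE BLOCK PAIR (`pdevOn (loK L j z) (bondHiK L j z κ) U₀ < α₀η²`) and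
  `‖U₀(∂p) − 1‖ ≤ α` for the unit plaquettes `p` inside the block pair (`0 < α`, `2dLʲ·α ≤ 1∕4`, `2·(4dLʲ+1)·α ≤ β′`); a slot `A` supported on the
  bonds at ONE site `x₀` with pairwise commuting values there (every one-parameter slot) and `‖A(b)‖ ≤ a` on the block pair (`0 < a`); `j ≤ k`:
  **`‖∂_τ²|₀ Q_j(U₀, τA)(c)‖ ≤ 8·Lʲ·a²·((4dLʲ+1)·α)∕(β·β′)`** — «DIAGONAL CURVATURE ∝ NON-FLATNESS» AT EVERY LEVEL `j ≤ k` FOR THE PRINTED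
  `Q_j`, the non-flatness being the plaquette deviation `α` on the block pair (crude constant; honest exponents `a²·α¹`).
Route: `W := π^*U₀` (clamped; `G`-valued, all plaquette variables within `α` of `1`, (52) globally); `v := axialFn W (Lʲz)` (`G`- and `U1`-valued);
`V₀ := W^{v}`, `‖V₀(b) − 1‖ ≤ |b₋ − Lʲz|₁·α ≤ 2dLʲ·α` on the block pair (`axial_bond_bound`); `B := log V₀` there (`0` elsewhere),
`‖B‖ ≤ (4dLʲ+1)α`, `e^{B} ≡ V₀` on the block pair (`exp_mlog`); `U₀ ≡ W = V₀^{v⁻¹}` on the block pair;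
the truncated slot `A_t = (A″)^{v⁻¹}` with `A″ = vA_tv⁻¹`
one-site-commuting, `‖A″‖ ≤ a`; locality ⟹ covariance (`‖·‖` non-increasing, `v⁻¹ ∈ U1`) ⟹ locality ⟹ file 19's `norm_levels_curvature_le_of_commute`
at the background `e^{B}` with the slot `A″` (analyticity input for the covariance step: file 19's `analyticAt_logCovIter_slot` at `V₀`,
(52) for `V₀` by (45) `pdev_gaugeAct`).
What it does NOT do: optimal constants; Prop. 4's (121)∕(136) bookkeeping; NODE O.

HONEST FRAMING.  [folklore] bookkeeping over the lineages' verbatim ℤᵈ model of [B7] and their kernel Propositions 4∕7; nothing of Bałaban's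
asserted beyond print; NE1′ NOT proved; spine 0∕9; (B) 0∕13; binders 0∕6; one finite T⁴ — NOT ℝ⁴, NOT infinite volume, NOT a mass gap, NOT Clay.
-/

noncomputable section

open scoped Topology BigOperators
open NormedSpace Filter Metric Set

namespace Summit.QuantumFields.BalabanUV.T4Continuum.NE1p.B7AveragingCommutator

open Literature.MathematicalPhysics.QuantumFieldTheory.Balaban1983to89.B7Prop1Explicit
open Literature.MathematicalPhysics.QuantumFieldTheory.Balaban1983to89.B7Prop1Local (InBox AgreeOn PlaqIn loK bondHiK clampCfg
  clampCfg_agree clampCfg_mem norm_hol_plaqWord_clampCfg_le pdevOn pdev_clampCfg_le add_e_apply)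
open Literature.MathematicalPhysics.QuantumFieldTheory.Balaban1983to89.B7Prop2Explicit (avgIter pdev C0 c2' AvgClosed hol_mem_of)
open Literature.MathematicalPhysics.QuantumFieldTheory.Balaban1983to89.B7Prop3Flat (expCfg c3)
open Literature.MathematicalPhysics.QuantumFieldTheory.Balaban1983to89.B7Prop3GeneralRotated (expCfg_zero)
open Literature.MathematicalPhysics.QuantumFieldTheory.Balaban1983to89.B7Prop4GeneralLevels (logCovIter)
open Literature.MathematicalPhysics.QuantumFieldTheory.Balaban1983to89.B7AvgGaugeCovariance (pdev_gaugeAct)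
open Literature.MathematicalPhysics.QuantumFieldTheory.Balaban1983to89.B7LocalityGeneral (logCovIter_congr)
open Literature.MathematicalPhysics.QuantumFieldTheory.Balaban1983to89.MatrixLog (mlog exp_mlog norm_mlog_le_two_mul)
open Literature.MathematicalPhysics.QuantumFieldTheory.Balaban1983to89.B7AvgGaugeCovariance (uLev uLev_apply)
open Summit.QuantumFields.BalabanUV.T4Continuum.NE1p.B7AveragingAbelianSector (pdev_one_lt)

variable {d : ℕ} {𝔸 : Type*} [NormedRing 𝔸] [NormedAlgebra ℂ 𝔸] [CompleteSpace 𝔸] [NormOneClass 𝔸]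

/-! ## §1 Bookkeeping on the level-`j` block pair -/

section Box

variable (L : ℕ)

omit [NormedAlgebra ℂ 𝔸] [CompleteSpace 𝔸] [NormOneClass 𝔸] in
/-- On the block pair `[Lʲz, Lʲz + (Lʲ−1)𝟙 + Lʲe_κ]` the `ℓ¹` distance to the corner `Lʲz` is at most `2dLʲ`. [folklore] -/
theorem l1_sub_loK_le_of_inBox (j : ℕ) (z : Site d) (κ : Fin d) {x : Site d} (hx : InBox (loK L j z) (bondHiK L j z κ) x) :
    (l1 (x - loK L j z) : ℝ) ≤ 2 * d * (L : ℝ) ^ j := by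
  have h1 : l1 (x - loK L j z) ≤ d * (2 * L ^ j) := by
    unfold l1
    have hb : ∀ i ∈ (Finset.univ : Finset (Fin d)), ((x - loK L j z) i).natAbs ≤ 2 * L ^ j := fun i _ => by
      have h := hx i
      have hP : ((L ^ j : ℕ) : ℤ) = (L : ℤ) ^ j := by push_cast; ring
      simp only [bondHiK, loK] at h
      simp only [Pi.sub_apply, loK]
      generalize hPP : (L : ℤ) ^ j = P at h hP
      generalize hQQ : (L ^ j : ℕ) = Q at hP ⊢
      split_ifs at h <;> omega
    have := Finset.sum_le_card_nsmul _ _ _ hb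
    simpa using this
  calc (l1 (x - loK L j z) : ℝ) ≤ ((d * (2 * L ^ j) : ℕ) : ℝ) := by exact_mod_cast h1
    _ = 2 * d * (L : ℝ) ^ j := by push_cast; ring

omit [NormOneClass 𝔸] in
/-- **Locality of `Q_j(U₀, τA)(c)` in `(U₀, A)` on the block pair** (the lineage's kernel `logCovIter_congr`).
[cite: Balaban1985Averaging, p.24 (sentence after (43)), (127) p.37, p.34] -/
theorem logCovIter_slot_congr (hL : 1 ≤ L) (j : ℕ) (z : Site d) (κ : Fin d) {U₀ U₀' : Site d → Fin d → 𝔸ˣ}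
    {A A' : Site d → Fin d → 𝔸} (hU : AgreeOn (loK L j z) (bondHiK L j z κ) U₀ U₀')
    (hA : AgreeOn (loK L j z) (bondHiK L j z κ) A A') (τ : ℂ) :
    logCovIter L U₀ (τ • A) j z κ = logCovIter L U₀' (τ • A') j z κ :=
  logCovIter_congr L hL j z κ hU fun x μ hx hxe => by simp only [Pi.smul_apply, hA x μ hx hxe]

omit [NormOneClass 𝔸] in
/-- … hence locality of the quadratic term. [cite: Balaban1985Averaging, p.24 (sentence after (43)), (127) p.37] -/
theorem iteratedDeriv_two_logCovIter_slot_congr (hL : 1 ≤ L) (j : ℕ) (z : Site d) (κ : Fin d) {U₀ U₀' : Site d → Fin d → 𝔸ˣ}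
    {A A' : Site d → Fin d → 𝔸} (hU : AgreeOn (loK L j z) (bondHiK L j z κ) U₀ U₀')
    (hA : AgreeOn (loK L j z) (bondHiK L j z κ) A A') :
    iteratedDeriv 2 (fun τ : ℂ => logCovIter L U₀ (τ • A) j z κ) 0 = iteratedDeriv 2 (fun τ : ℂ => logCovIter L U₀' (τ • A') j z κ) 0 := by
  rw [show (fun τ : ℂ => logCovIter L U₀ (τ • A) j z κ) = fun τ : ℂ => logCovIter L U₀' (τ • A') j z κ from
    funext fun τ => logCovIter_slot_congr L hL j z κ hU hA τ]

end Box

/-! ## §2 «Diagonal curvature ∝ non-flatness» at every level, in the printed local currency -/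

section Plaq

variable (L : ℕ) (hL : 2 ≤ L) {G : Subgroup 𝔸ˣ} (hG : AvgClosed d L G) (k : ℕ) {α₀ : ℝ} (hα : 0 < α₀)
  (hα3 : C0 d * α₀ ≤ 1 / 3) (hα8 : 8 * α₀ ≤ c2' d L)
  {β β' : ℝ} (hβ : 0 < β) (hβ' : 0 < β')
  (hsmall' : Real.exp (4 * (800 * ((d : ℝ) + 1) ^ 2 * ((d : ℝ) + 4)) * α₀)
    * (1 + 8 * (131072 * ((d : ℝ) + 1) ^ 2) * ((L : ℝ) ^ k * β')) ≤ 2)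
  (hc₃' : 2 * ((L : ℝ) ^ k * β') ≤ c3 d L) (hb'1 : 409600 * ((d : ℝ) + 1) ^ 2 * ((L : ℝ) ^ k * β') ≤ 1)
  (hsmall : Real.exp (4480 * ((d : ℝ) + 1) ^ 2 * ((d : ℝ) + 4) * α₀ + 240000 * ((d : ℝ) + 1) ^ 3 * ((L : ℝ) ^ k * β'))
    * (1 + 8 * (2097152 * ((d : ℝ) + 1) ^ 2) * ((L : ℝ) ^ k * β)) ≤ 2)
  (hc₃ : 2 * ((L : ℝ) ^ k * β) ≤ c3 d L / 4)

include hL hG hα hα3 hα8 hβ hβ' hsmall' hc₃' hb'1 hsmall hc₃ in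
/-- **DOOR (c) AT EVERY LEVEL UNDER THE PRINTED LOCAL HYPOTHESIS — general slot.**  Let `c = ⟨z, z + e_κ⟩` be a bond of the `j`-th lattice,
`j ≤ k`; `U₀` a `G`-valued background with (52) on the block pair `B^j(c₋) ∪ B^j(c₊)` (`pdevOn … U₀ < α₀η²`) whose unit plaquettes inside the
block pair satisfy `‖U₀(∂p) − 1‖ ≤ α`, `0 < α`, `2dLʲ·α ≤ 1∕4`, `2·(4dLʲ+1)·α ≤ β′`; `A` any slot with `‖A(b)‖ ≤ a` on the block pair,
`0 < a`; `v` = the axial gauge (p. 24) based at `Lʲz` of the clamped extension of `U₀|_{B^j(c₋)∪B^j(c₊)}`, `A♮ = v·A·v⁻¹` the transported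
slot.  Then `‖∂_τ²|₀ Q_j(U₀, τA)(c) − ∂_τ²|₀ Q_j(1, τA♮)(c)‖ ≤ 8·Lʲ·a²·((4dLʲ+1)·α)∕(β·β′)` — the quadratic term at `U₀` is within
«non-flatness» of the FLAT quadratic term of the transported slot (covariance is exact here: `v(Lʲz) = 1`).
[cite: Balaban1985Averaging, (44) p.24, pp.24–25, (45) p.24, (52) p.26, (127) p.37, Proposition 7 p.43] -/
theorem norm_levels_curvature_sub_axialFlat_le_of_plaq (U₀ : Site d → Fin d → 𝔸ˣ) (hU₀ : ∀ x μ, U₀ x μ ∈ G) {j : ℕ} (hj : j ≤ k)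
    (z : Site d) (κ : Fin d) (h52 : pdevOn (loK L j z) (bondHiK L j z κ) U₀ < α₀ * (((L : ℝ) ^ k)⁻¹) ^ 2)
    {α : ℝ} (hαp : 0 < α)
    (h44 : ∀ (x : Site d) (μ ν : Fin d), μ ≠ ν → PlaqIn (loK L j z) (bondHiK L j z κ) (x, μ, ν) →
      ‖((hol U₀ x (plaqWord μ ν) : 𝔸ˣ) : 𝔸) - 1‖ ≤ α)
    (hαs : 2 * d * (L : ℝ) ^ j * α ≤ 1 / 4) (hbβ : 2 * ((4 * d * (L : ℝ) ^ j + 1) * α) ≤ β')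
    {A : Site d → Fin d → 𝔸} {a : ℝ} (ha0 : 0 < a)
    (ha : ∀ (x : Site d) (μ : Fin d), InBox (loK L j z) (bondHiK L j z κ) x → InBox (loK L j z) (bondHiK L j z κ) (x + e μ) →
      ‖A x μ‖ ≤ a) :
    ‖iteratedDeriv 2 (fun τ : ℂ => logCovIter L U₀ (τ • A) j z κ) 0
        - iteratedDeriv 2 (fun τ : ℂ => logCovIter L (1 : Site d → Fin d → 𝔸ˣ) (τ • fun x μ =>
            ((axialFn (clampCfg (loK L j z) (bondHiK L j z κ) U₀) (loK L j z) x : 𝔸ˣ) : 𝔸) * A x μ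
              * (((axialFn (clampCfg (loK L j z) (bondHiK L j z κ) U₀) (loK L j z) x)⁻¹ : 𝔸ˣ) : 𝔸)) j z κ) 0‖
      ≤ 8 * (L : ℝ) ^ j * a ^ 2 * ((4 * d * (L : ℝ) ^ j + 1) * α) / (β * β') := by
  classical
  have hL1 : 1 ≤ L := le_trans (by norm_num) hL
  set lo := loK L j z with hlo
  set hi := bondHiK L j z κ with hhi
  have hlohi : ∀ i, lo i ≤ hi i := fun i => by
    have hP : (1 : ℤ) ≤ (L : ℤ) ^ j := one_le_pow₀ (by exact_mod_cast hL1)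
    simp only [hlo, hhi, loK, bondHiK]
    split_ifs <;> linarith
  -- (i) the clamped extension `W = π^*U₀`
  set W := clampCfg lo hi U₀ with hW
  have hWU : AgreeOn lo hi W U₀ := clampCfg_agree U₀
  have hWG : ∀ x μ, W x μ ∈ G := clampCfg_mem hU₀
  have hWU1 : ∀ x μ, W x μ ∈ U1 𝔸 := fun x μ => hG.le_U1 (hWG x μ)
  have h44W : ∀ (x : Site d) (μ ν : Fin d), μ ≠ ν → ‖((hol W x (plaqWord μ ν) : 𝔸ˣ) : 𝔸) - 1‖ ≤ α :=
    fun x μ ν hμν => norm_hol_plaqWord_clampCfg_le hlohi U₀ hμν hαp.le (fun y hy => h44 y μ ν hμν hy) x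
  have h52W : pdev W < α₀ * (((L : ℝ) ^ k)⁻¹) ^ 2 :=
    (pdev_clampCfg_le hlohi (fun x μ => hG.le_U1 (hU₀ x μ))).trans_lt h52
  -- (ii) the axial gauge based at the corner `Lʲz`
  set v : Site d → 𝔸ˣ := axialFn W lo with hv
  have hvG : ∀ x, v x ∈ G := fun x => by simp only [hv, axialFn]; exact hol_mem_of hWG _ _
  have hvU1 : ∀ x, v x ∈ U1 𝔸 := fun x => axialFn_mem hWU1 lo x
  have hum : ∀ x, (v x)⁻¹ ∈ U1 𝔸 := fun x => (U1 𝔸).inv_mem (hvU1 x)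
  have hvlo : v lo = 1 := by simp [hv, axialFn]
  set V₀ := gaugeAct v W with hV₀
  have hV₀G : ∀ x μ, V₀ x μ ∈ G := fun x μ => by
    simp only [hV₀, gaugeAct]; exact G.mul_mem (G.mul_mem (hvG x) (hWG x μ)) (G.inv_mem (hvG _))
  have h52V₀ : pdev V₀ < α₀ * (((L : ℝ) ^ k)⁻¹) ^ 2 := by rw [hV₀, pdev_gaugeAct hvU1]; exact h52W
  have hV₀b : ∀ (x : Site d) (μ : Fin d), InBox lo hi x → ‖((V₀ x μ : 𝔸ˣ) : 𝔸) - 1‖ ≤ 2 * d * (L : ℝ) ^ j * α := fun x μ hx => by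
    have h := axial_bond_bound W hWU1 lo h44W hαp.le x μ
    exact h.trans (mul_le_mul_of_nonneg_right (l1_sub_loK_le_of_inBox L j z κ hx) hαp.le)
  have hb0 : 0 < (4 * d * (L : ℝ) ^ j + 1) * α := by positivity
  -- (iii) the generator `B = log V₀` on the block pair
  let B : Site d → Fin d → 𝔸 := fun x μ => if InBox lo hi x ∧ InBox lo hi (x + e μ) then mlog ((V₀ x μ : 𝔸ˣ) : 𝔸) else 0
  have hBb : ∀ (x : Site d) (μ : Fin d), ‖B x μ‖ ≤ (4 * d * (L : ℝ) ^ j + 1) * α := fun x μ =>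
    norm_ite_zero_le_of (fun h => (norm_mlog_le_two_mul ((hV₀b x μ h.1).trans (by linarith))).trans
      (by nlinarith [hV₀b x μ h.1])) hb0.le
  have hBV₀ : AgreeOn lo hi (expCfg B) V₀ := fun x μ hx hxe => by
    apply Units.ext
    have h1 := hV₀b x μ hx
    show exp (B x μ) = ((V₀ x μ : 𝔸ˣ) : 𝔸)
    simp only [B, hx, hxe, and_self, if_true]
    exact exp_mlog (h1.trans_lt (by linarith))
  -- (iv) `U₀ ≡ W = V₀^{v⁻¹}` on the block pair
  have hWV : W = gaugeAct (fun x => (v x)⁻¹) V₀ := by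
    funext x μ; simp only [hV₀, gaugeAct, inv_inv]; group
  -- (v) truncate the slot, transport it
  let At : Site d → Fin d → 𝔸 := fun x μ => if InBox lo hi x ∧ InBox lo hi (x + e μ) then A x μ else 0
  let A'' : Site d → Fin d → 𝔸 := fun x μ => (v x : 𝔸) * At x μ * (((v x)⁻¹ : 𝔸ˣ) : 𝔸)
  have hAAt : AgreeOn lo hi A At := fun x μ hx hxe => by simp only [At, hx, hxe, and_self, if_true]
  have hAtA'' : ∀ (x : Site d) (μ : Fin d), At x μ = (((v x)⁻¹ : 𝔸ˣ) : 𝔸) * A'' x μ * ((((v x)⁻¹)⁻¹ : 𝔸ˣ) : 𝔸) := fun x μ => by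
    simp only [A'', inv_inv, ← mul_assoc, Units.inv_mul, one_mul, Units.inv_mul_cancel_right]
  have ha'' : ∀ (x : Site d) (μ : Fin d), ‖A'' x μ‖ ≤ a := fun x μ => by
    have hAt0 : ‖At x μ‖ ≤ a := norm_ite_zero_le_of (fun h => ha x μ h.1 h.2) ha0.le
    calc ‖A'' x μ‖ ≤ ‖(v x : 𝔸) * At x μ‖ * ‖(((v x)⁻¹ : 𝔸ˣ) : 𝔸)‖ := norm_mul_le _ _
      _ ≤ (‖(v x : 𝔸)‖ * ‖At x μ‖) * 1 := mul_le_mul (norm_mul_le _ _) (hvU1 x).2 (norm_nonneg _) (by positivity)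
      _ ≤ (1 * a) * 1 := by gcongr; exact (hvU1 x).1
      _ = a := by ring
  -- the transported (untruncated) slot of the statement agrees with `A″` on the block pair
  have hnat : AgreeOn lo hi (fun x μ => (v x : 𝔸) * A x μ * (((v x)⁻¹ : 𝔸ˣ) : 𝔸)) A'' := fun x μ hx hxe => by
    simp only [A'', ← hAAt x μ hx hxe]
  -- (vi) analyticity of the slot ray at the background `V₀` (Prop. 7; (52) for `V₀` by (45))
  have hQ : AnalyticAt ℂ (fun τ : ℂ => logCovIter L V₀ (τ • A'') j z κ) 0 := by
    have h := analyticAt_logCovIter_slot L hL hG k hα hα3 hα8 hβ hβ' hsmall' hc₃' hb'1 hsmall hc₃ ha'' hBb V₀ hV₀G h52V₀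
      (s := 0) (τ₀ := 0) (by rw [norm_zero, zero_mul]; exact hβ'.le) (by rw [norm_zero, zero_mul]; exact hβ.le) hj z κ
    simpa only [zero_smul, expCfg_zero, one_mul] using h
  -- the conjugating unit of the covariance step is `v(Lʲz)⁻¹ = 1`
  have hu1 : uLev L (fun x => (v x)⁻¹) j z = 1 := by
    rw [uLev_apply]
    have hz : ((L : ℤ) ^ j • z : Site d) = lo := by
      funext i; simp only [hlo, loK, Pi.smul_apply, smul_eq_mul]
    rw [hz, hvlo, inv_one]
  -- assemble: locality ⟹ covariance (exact) ⟹ locality ⟹ file 19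
  have hcurved : iteratedDeriv 2 (fun τ : ℂ => logCovIter L U₀ (τ • A) j z κ) 0
      = iteratedDeriv 2 (fun τ : ℂ => logCovIter L (expCfg ((1 : ℂ) • B) * 1) (τ • A'') j z κ) 0 := by
    rw [iteratedDeriv_two_logCovIter_slot_congr L hL1 j z κ hWU.symm hAAt, hWV,
      iteratedDeriv_two_logCovIter_gaugeAct L (fun x => (v x)⁻¹) V₀ hAtA'' j z κ hQ, hu1, one_smul, mul_one,
      iteratedDeriv_two_logCovIter_slot_congr L hL1 j z κ hBV₀.symm (fun _ _ _ _ => rfl)]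
    simp only [Units.val_one, inv_one, one_mul, mul_one]
  have hflat : iteratedDeriv 2 (fun τ : ℂ => logCovIter L (1 : Site d → Fin d → 𝔸ˣ) (τ • fun x μ =>
        (v x : 𝔸) * A x μ * (((v x)⁻¹ : 𝔸ˣ) : 𝔸)) j z κ) 0
      = iteratedDeriv 2 (fun τ : ℂ => logCovIter L (expCfg ((0 : ℂ) • B) * 1) (τ • A'') j z κ) 0 := by
    rw [zero_smul, expCfg_zero, one_mul]
    exact iteratedDeriv_two_logCovIter_slot_congr L hL1 j z κ (fun _ _ _ _ => rfl) hnat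
  rw [hcurved, hflat]
  exact norm_levels_curvature_sub_le L hL hG k hα hα3 hα8 hβ hβ' hsmall' hc₃' hb'1 hsmall hc₃ ha0 hb0 ha'' hBb 1
    (fun _ _ => G.one_mem) (pdev_one_lt L hL k hα) hbβ hj z κ

include hL hG hα hα3 hα8 hβ hβ' hsmall' hc₃' hb'1 hsmall hc₃ in
/-- **«DIAGONAL CURVATURE ∝ NON-FLATNESS» AT EVERY LEVEL `j ≤ k`, PRINTED LOCAL CURRENCY.**  Under the hypotheses of
`norm_levels_curvature_sub_axialFlat_le_of_plaq`, if the slot `A` is supported on the bonds at ONE site `x₀` with pairwise commuting values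
there (every one-parameter slot), then `‖∂_τ²|₀ Q_j(U₀, τA)(c)‖ ≤ 8·Lʲ·a²·((4dLʲ+1)·α)∕(β·β′)` — the transported slot is again one-site with
commuting values, so its FLAT quadratic term vanishes (file 19's `iteratedDeriv_two_logCovIter_one_of_commute`, after truncation to the block pair
by locality). [cite: Balaban1985Averaging, (44) p.24, pp.24–25, (45) p.24, (52) p.26, (127) p.37, (134) p.38, Proposition 7 p.43] -/
theorem norm_levels_curvature_le_of_plaq_oneSite (U₀ : Site d → Fin d → 𝔸ˣ) (hU₀ : ∀ x μ, U₀ x μ ∈ G) {j : ℕ} (hj : j ≤ k)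
    (z : Site d) (κ : Fin d) (h52 : pdevOn (loK L j z) (bondHiK L j z κ) U₀ < α₀ * (((L : ℝ) ^ k)⁻¹) ^ 2)
    {α : ℝ} (hαp : 0 < α)
    (h44 : ∀ (x : Site d) (μ ν : Fin d), μ ≠ ν → PlaqIn (loK L j z) (bondHiK L j z κ) (x, μ, ν) →
      ‖((hol U₀ x (plaqWord μ ν) : 𝔸ˣ) : 𝔸) - 1‖ ≤ α)
    (hαs : 2 * d * (L : ℝ) ^ j * α ≤ 1 / 4) (hbβ : 2 * ((4 * d * (L : ℝ) ^ j + 1) * α) ≤ β')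
    {A : Site d → Fin d → 𝔸} {a : ℝ} (ha0 : 0 < a)
    (ha : ∀ (x : Site d) (μ : Fin d), InBox (loK L j z) (bondHiK L j z κ) x → InBox (loK L j z) (bondHiK L j z κ) (x + e μ) →
      ‖A x μ‖ ≤ a)
    (x₀ : Site d) (hsupp : ∀ (x : Site d) (μ : Fin d), x ≠ x₀ → A x μ = 0) (hcomm : ∀ (μ ν : Fin d), Commute (A x₀ μ) (A x₀ ν)) :
    ‖iteratedDeriv 2 (fun τ : ℂ => logCovIter L U₀ (τ • A) j z κ) 0‖
      ≤ 8 * (L : ℝ) ^ j * a ^ 2 * ((4 * d * (L : ℝ) ^ j + 1) * α) / (β * β') := by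
  classical
  have hL1 : 1 ≤ L := le_trans (by norm_num) hL
  have h := norm_levels_curvature_sub_axialFlat_le_of_plaq L hL hG k hα hα3 hα8 hβ hβ' hsmall' hc₃' hb'1 hsmall hc₃ U₀ hU₀ hj z κ
    h52 hαp h44 hαs hbβ ha0 ha
  set lo := loK L j z with hlo
  set hi := bondHiK L j z κ with hhi
  set v : Site d → 𝔸ˣ := axialFn (clampCfg lo hi U₀) lo with hv
  -- the transported slot, truncated to the block pair: one-site, commuting, bounded
  let At : Site d → Fin d → 𝔸 := fun x μ => if InBox lo hi x ∧ InBox lo hi (x + e μ) then A x μ else 0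
  let A'' : Site d → Fin d → 𝔸 := fun x μ => (v x : 𝔸) * At x μ * (((v x)⁻¹ : 𝔸ˣ) : 𝔸)
  have hAAt : AgreeOn lo hi A At := fun x μ hx hxe => by simp only [At, hx, hxe, and_self, if_true]
  have hnat : AgreeOn lo hi (fun x μ => (v x : 𝔸) * A x μ * (((v x)⁻¹ : 𝔸ˣ) : 𝔸)) A'' := fun x μ hx hxe => by
    simp only [A'', ← hAAt x μ hx hxe]
  have hAt0 : ∀ (x : Site d) (μ : Fin d), x ≠ x₀ → At x μ = 0 := fun x μ hx => by
    simp only [At]; split_ifs; exacts [hsupp x μ hx, rfl]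
  have hWU1 : ∀ x μ, clampCfg lo hi U₀ x μ ∈ U1 𝔸 := fun x μ => hG.le_U1 (clampCfg_mem hU₀ x μ)
  have hvU1 : ∀ x, v x ∈ U1 𝔸 := fun x => axialFn_mem hWU1 lo x
  have ha'' : ∀ (x : Site d) (μ : Fin d), ‖A'' x μ‖ ≤ a := fun x μ => by
    have hAt0 : ‖At x μ‖ ≤ a := norm_ite_zero_le_of (fun h => ha x μ h.1 h.2) ha0.le
    calc ‖A'' x μ‖ ≤ ‖(v x : 𝔸) * At x μ‖ * ‖(((v x)⁻¹ : 𝔸ˣ) : 𝔸)‖ := norm_mul_le _ _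
      _ ≤ (‖(v x : 𝔸)‖ * ‖At x μ‖) * 1 := mul_le_mul (norm_mul_le _ _) (hvU1 x).2 (norm_nonneg _) (by positivity)
      _ ≤ (1 * a) * 1 := by gcongr; exact (hvU1 x).1
      _ = a := by ring
  have hA''c : ∀ (x : Site d) (μ : Fin d) (y : Site d) (ν : Fin d), Commute (A'' x μ) (A'' y ν) := by
    intro x μ y ν
    by_cases hx : x = x₀
    · by_cases hy : y = x₀
      · rw [hx, hy]
        have hcA : Commute (At x₀ μ) (At x₀ ν) := by
          simp only [At]; split_ifs
          exacts [hcomm μ ν, Commute.zero_right _, Commute.zero_left _, Commute.zero_left _]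
        have hc := hcA.eq
        show _ * _ = _ * _
        simp only [A'', mul_assoc, Units.inv_mul_cancel_left]
        rw [← mul_assoc (At x₀ μ), hc, mul_assoc]
      · simp only [A'', hAt0 y ν hy, mul_zero, zero_mul]; exact Commute.zero_right _
    · simp only [A'', hAt0 x μ hx, mul_zero, zero_mul]; exact Commute.zero_left _
  -- the flat quadratic term of the transported slot vanishes
  have hflat0 : iteratedDeriv 2 (fun τ : ℂ => logCovIter L (1 : Site d → Fin d → 𝔸ˣ) (τ • fun x μ =>
        (v x : 𝔸) * A x μ * (((v x)⁻¹ : 𝔸ˣ) : 𝔸)) j z κ) 0 = 0 := by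
    rw [iteratedDeriv_two_logCovIter_slot_congr L hL1 j z κ (fun _ _ _ _ => rfl) hnat]
    exact iteratedDeriv_two_logCovIter_one_of_commute L hL hG k hα hα3 hα8 hA''c ha0.le ha'' hj z κ
  rwa [hflat0, sub_zero] at h

end Plaq

end Summit.QuantumFields.BalabanUV.T4Continuum.NE1p.B7AveragingCommutator

end
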